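import Literature.Analysis.FluidPDE.CaloricKernelFamilies
import Mathlib.Analysis.SpecialFunctions.Integrals.Basic
import HarnessLib

/-!
# The kernels of the backward Duhamel representation: vanishing, slab integrals, shell bounds

Analysis/FluidPDE support file (everything proved) on the discharge path of the named fact
`Literature.Analysis.FluidPDE.Carleman.seregin_backwardHeat_localMax_le_L2`
(`BackwardHeatRegularity.lean`; Seregin 2014, App. A.2, Remark A.2). The representation formulas
of `HeatPotentialRepresentation.lean` for the backward heat operator `∂ₜ + Δ` express a
compactly supported `C²` function `W` and its spatial gradient at `z₀ = (s₀, y₀)` as integrals of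
`(∂ₜ + Δ)W` against the kernels

* `k_G(w) = backKernel G (s₀ - s, y - y₀) = G_{s - s₀}(y - y₀)` (`w = (s, y)`, `s > s₀`; zero for
  `s ≤ s₀`), `G_a` the Gauss–Weierstrass kernel (`UnboundedOperators.heatKernel a`),
* `k_v(w) = backKernel (∂ᵥG) (s₀ - s, y - y₀) = (∂ᵥG_{s - s₀})(y - y₀)` (`heatKernelGrad`).

This file records the three properties of these kernels that the local maximum estimate uses:

* **support in the future**: `k(w) = 0` for `s ≤ s₀` (`backKernel_shift_eq_zero_of_le`);
* **slab integrals**: `∫_{s₀ < s ≤ s₀ + T} k_G = T` and `∫_{s₀ < s ≤ s₀ + T} |k_v| ≤ 2^{d/2} ‖v‖ · 2√T`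
  (unit mass of `G_a`, the slice bound `∫ |∂ᵥG_a| ≤ 2^{d/2}‖v‖ a^{-1/2}` of
  `CaloricBackwardKernels.lean`, Tonelli, `∫₀ᵀ a^{-1/2} da = 2√T`), with the integrability
  statements;
* **shell bounds**: off the parabolic half-ball, i.e. for `s - s₀ ≥ ρ²/2` or `‖y - y₀‖ ≥ ρ/2`,
  `|k_G(w)|, |k_v(w)| ≤ B ρ^{-(d+1)}` for `0 < ρ ≤ 1`, `‖v‖ ≤ 1`, with `B = B(E)`
  (`exists_shell_bound`; Gaussian decay against the parabolic distance, Koch–Tataru 2001, §2 (8),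
  through the tree's `exists_heatKernel_le_of_le_norm`, `exists_abs_heatKernelGrad_le_of_le_norm`,
  `exists_abs_heatKernelGrad_le_of_le`, `abs_heatKernel_le_of_le`).

## References

* L. C. Evans, *Partial Differential Equations*, 2nd ed., AMS 2010, §2.3.1.
* H. Koch, D. Tataru, Adv. Math. 157 (2001), §2 (8).
-/

noncomputable section

open MeasureTheory Set Function Filter Metric Real
open scoped ENNReal NNReal Topology RealInnerProductSpace

namespace Literature.Analysis.FluidPDE

namespace Carleman

variable {E : Type*} [NormedAddCommGroup E] [InnerProductSpace ℝ E] [FiniteDimensional ℝ E]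
  [MeasurableSpace E] [BorelSpace E]

/-! ### The shifted backward kernels -/

omit [FiniteDimensional ℝ E] [MeasurableSpace E] [BorelSpace E] [InnerProductSpace ℝ E] in
/-- **The kernels live in the future**: `backKernel κ (s₀ - s, y - y₀) = 0` for `s ≤ s₀`.
[folklore] -/
theorem backKernel_shift_eq_zero_of_le [NormedSpace ℝ E] (κ : ℝ → E → ℝ) (s₀ : ℝ) (y₀ : E)
    {w : ℝ × E} (h : w.1 ≤ s₀) : backKernel κ (s₀ - w.1, w.2 - y₀) = 0 :=
  backKernel_of_nonneg κ (sub_nonneg.2 h) _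

omit [FiniteDimensional ℝ E] [MeasurableSpace E] [BorelSpace E] [InnerProductSpace ℝ E] in
/-- For `s > s₀`: `backKernel κ (s₀ - s, y - y₀) = κ (s - s₀) (y - y₀)`. [folklore] -/
theorem backKernel_shift_of_lt [NormedSpace ℝ E] (κ : ℝ → E → ℝ) (s₀ : ℝ) (y₀ : E) {w : ℝ × E}
    (h : s₀ < w.1) : backKernel κ (s₀ - w.1, w.2 - y₀) = κ (w.1 - s₀) (w.2 - y₀) := by
  rw [backKernel_of_neg κ (sub_neg.2 h)]
  simp [neg_sub]

/-- The shift `w ↦ (s₀ - s, y - y₀)` is measurable. [folklore] -/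
theorem measurable_shift (s₀ : ℝ) (y₀ : E) :
    Measurable fun w : ℝ × E => (s₀ - w.1, w.2 - y₀) :=
  (measurable_const.sub measurable_fst).prodMk (measurable_snd.sub measurable_const)

/-- Measurability of `k_G`. [folklore] -/
theorem measurable_backKernel_heatKernel_shift (s₀ : ℝ) (y₀ : E) :
    Measurable fun w : ℝ × E =>
      backKernel (UnboundedOperators.heatKernel (E := E)) (s₀ - w.1, w.2 - y₀) :=
  (measurable_backKernel continuousOn_heatKernel_family).comp (measurable_shift s₀ y₀)

/-- Measurability of `k_v`. [folklore] -/
theorem measurable_backKernel_heatKernelGrad_shift (v : E) (s₀ : ℝ) (y₀ : E) :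
    Measurable fun w : ℝ × E => backKernel (heatKernelGrad v) (s₀ - w.1, w.2 - y₀) :=
  (measurable_backKernel (continuousOn_heatKernelGrad_family v)).comp (measurable_shift s₀ y₀)

omit [FiniteDimensional ℝ E] [MeasurableSpace E] [BorelSpace E] in
/-- `k_G ≥ 0`. [folklore] -/
theorem backKernel_heatKernel_shift_nonneg (s₀ : ℝ) (y₀ : E) (w : ℝ × E) :
    0 ≤ backKernel (UnboundedOperators.heatKernel (E := E)) (s₀ - w.1, w.2 - y₀) := by
  by_cases h : w.1 ≤ s₀
  · rw [backKernel_shift_eq_zero_of_le _ s₀ y₀ h]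
  · rw [backKernel_shift_of_lt _ s₀ y₀ (not_le.1 h)]
    exact (UnboundedOperators.heatKernel_pos (sub_pos.2 (not_le.1 h)) _).le

/-! ### Slab integrals -/

/-- A set integral over a slab `(s₀, s₀ + T] × E` is an iterated integral (Tonelli). [folklore] -/
theorem lintegral_slab_eq (s₀ T : ℝ) (f : ℝ × E → ℝ≥0∞) (hf : Measurable f) :
    ∫⁻ w in Ioc s₀ (s₀ + T) ×ˢ (univ : Set E), f w =
      ∫⁻ s in Ioc s₀ (s₀ + T), ∫⁻ y, f (s, y) := by
  rw [Measure.volume_eq_prod, ← Measure.restrict_univ (μ := (volume : Measure E)),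
    ← Measure.prod_restrict, Measure.restrict_univ]
  exact lintegral_prod _ hf.aemeasurable

/-- **Unit mass on each future slice**: `∫ k_G(s, y) dy = 1` for `s > s₀`. [folklore] -/
theorem lintegral_backKernel_heatKernel_shift_slice (s₀ : ℝ) (y₀ : E) {s : ℝ} (hs : s₀ < s) :
    ∫⁻ y, ‖backKernel (UnboundedOperators.heatKernel (E := E)) (s₀ - s, y - y₀)‖ₑ = 1 := by
  have h : ∀ y : E, backKernel (UnboundedOperators.heatKernel (E := E)) (s₀ - s, y - y₀) =
      UnboundedOperators.heatKernel (s - s₀) (y - y₀) := fun y =>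
    backKernel_shift_of_lt _ s₀ y₀ (w := (s, y)) hs
  simp_rw [h]
  rw [lintegral_sub_right_eq_self (fun y => ‖UnboundedOperators.heatKernel (E := E) (s - s₀) y‖ₑ) y₀]
  exact UnboundedOperators.lintegral_enorm_heatKernel (sub_pos.2 hs)

/-- **Slab integral of `k_G`**: `∫_{(s₀, s₀+T] × E} k_G = T` (in `ℝ≥0∞` form). [folklore] -/
theorem lintegral_slab_backKernel_heatKernel_shift (s₀ : ℝ) (y₀ : E) (T : ℝ) :
    ∫⁻ w in Ioc s₀ (s₀ + T) ×ˢ (univ : Set E),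
      ‖backKernel (UnboundedOperators.heatKernel (E := E)) (s₀ - w.1, w.2 - y₀)‖ₑ = ENNReal.ofReal T := by
  rw [lintegral_slab_eq s₀ T _ (measurable_backKernel_heatKernel_shift s₀ y₀).enorm]
  rw [setLIntegral_congr_fun measurableSet_Ioc (g := fun _ => 1) fun s hs =>
    lintegral_backKernel_heatKernel_shift_slice s₀ y₀ hs.1]
  rw [setLIntegral_const, Real.volume_Ioc, one_mul]
  congr 1
  ring

/-- `k_G` is integrable on every slab `(s₀, s₀ + T] × E`. [folklore] -/
theorem integrableOn_slab_backKernel_heatKernel_shift (s₀ : ℝ) (y₀ : E) (T : ℝ) :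
    IntegrableOn (fun w : ℝ × E =>
      backKernel (UnboundedOperators.heatKernel (E := E)) (s₀ - w.1, w.2 - y₀))
      (Ioc s₀ (s₀ + T) ×ˢ (univ : Set E)) volume := by
  refine ⟨(measurable_backKernel_heatKernel_shift s₀ y₀).aestronglyMeasurable, ?_⟩
  rw [hasFiniteIntegral_iff_enorm, lintegral_slab_backKernel_heatKernel_shift s₀ y₀ T]
  exact ENNReal.ofReal_lt_top

/-- **Slab integral of `k_G`, real form**: `∫_{(s₀, s₀+T] × E} k_G = T`. [folklore] -/
theorem setIntegral_slab_backKernel_heatKernel_shift (s₀ : ℝ) (y₀ : E) {T : ℝ} (hT : 0 ≤ T) :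
    ∫ w in Ioc s₀ (s₀ + T) ×ˢ (univ : Set E),
      backKernel (UnboundedOperators.heatKernel (E := E)) (s₀ - w.1, w.2 - y₀) = T := by
  rw [integral_eq_lintegral_of_nonneg_ae
    (Eventually.of_forall fun w => backKernel_heatKernel_shift_nonneg s₀ y₀ w)
    (measurable_backKernel_heatKernel_shift s₀ y₀).aestronglyMeasurable]
  have h := lintegral_slab_backKernel_heatKernel_shift (E := E) s₀ y₀ T
  have h' : ∫⁻ w in Ioc s₀ (s₀ + T) ×ˢ (univ : Set E),
      ENNReal.ofReal (backKernel (UnboundedOperators.heatKernel (E := E)) (s₀ - w.1, w.2 - y₀)) =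
      ENNReal.ofReal T := by
    rw [← h]
    refine lintegral_congr fun w => ?_
    rw [Real.enorm_eq_ofReal (backKernel_heatKernel_shift_nonneg s₀ y₀ w)]
  rw [h', ENNReal.toReal_ofReal hT]

/-- `∫_{s₀}^{s₀+T} (s - s₀)^{-1/2} ds = 2√T`, as a set integral over `(s₀, s₀ + T]`. [folklore] -/
theorem setIntegral_Ioc_rpow_neg_half (s₀ : ℝ) {T : ℝ} (hT : 0 ≤ T) :
    ∫ s in Ioc s₀ (s₀ + T), (s - s₀) ^ (-(1 / 2 : ℝ)) = 2 * Real.sqrt T := by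
  rw [← intervalIntegral.integral_of_le (by linarith), intervalIntegral.integral_comp_sub_right
    (fun x => x ^ (-(1 / 2 : ℝ))) s₀, sub_self, show s₀ + T - s₀ = T by ring,
    integral_rpow (Or.inl (by norm_num))]
  rw [show -(1 / 2 : ℝ) + 1 = 1 / 2 by norm_num, Real.zero_rpow (by norm_num), sub_zero,
    Real.sqrt_eq_rpow]
  ring

/-- `(s - s₀)^{-1/2}` is integrable on `(s₀, s₀ + T]`. [folklore] -/
theorem integrableOn_Ioc_rpow_neg_half (s₀ T : ℝ) :
    IntegrableOn (fun s => (s - s₀) ^ (-(1 / 2 : ℝ))) (Ioc s₀ (s₀ + T)) volume := by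
  by_cases hT : 0 ≤ T
  · have h := (intervalIntegral.intervalIntegrable_rpow' (a := 0) (b := T)
      (by norm_num : -1 < -(1 / 2 : ℝ))).comp_sub_right s₀
    have h' : IntervalIntegrable (fun s => (s - s₀) ^ (-(1 / 2 : ℝ))) volume s₀ (s₀ + T) := by
      simpa [add_comm] using h
    exact (intervalIntegrable_iff_integrableOn_Ioc_of_le (by linarith)).1 h'
  · rw [Ioc_eq_empty (by linarith)]
    exact integrableOn_empty

/-- **Slab integral of `|k_v|`**: `∫_{(s₀, s₀+T] × E} |k_v| ≤ 2^{d/2} ‖v‖ · 2√T` (in `ℝ≥0∞` form).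
[folklore] -/
theorem lintegral_slab_backKernel_heatKernelGrad_shift_le (v : E) (s₀ : ℝ) (y₀ : E) {T : ℝ}
    (hT : 0 ≤ T) :
    ∫⁻ w in Ioc s₀ (s₀ + T) ×ˢ (univ : Set E), ‖backKernel (heatKernelGrad v) (s₀ - w.1, w.2 - y₀)‖ₑ ≤
      ENNReal.ofReal ((2 : ℝ) ^ ((Module.finrank ℝ E : ℝ) / 2) * ‖v‖ * (2 * Real.sqrt T)) := by
  set C : ℝ := (2 : ℝ) ^ ((Module.finrank ℝ E : ℝ) / 2) * ‖v‖ with hC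
  have hC0 : 0 ≤ C := by positivity
  rw [lintegral_slab_eq s₀ T _ (measurable_backKernel_heatKernelGrad_shift v s₀ y₀).enorm]
  have hslice : ∀ s ∈ Ioc s₀ (s₀ + T),
      ∫⁻ y, ‖backKernel (heatKernelGrad v) (s₀ - s, y - y₀)‖ₑ ≤
        ENNReal.ofReal (C * (s - s₀) ^ (-(1 / 2 : ℝ))) := by
    intro s hs
    have hpos : 0 < s - s₀ := sub_pos.2 hs.1
    have h : ∀ y : E, backKernel (heatKernelGrad v) (s₀ - s, y - y₀) =
        heatKernelGrad v (s - s₀) (y - y₀) := fun y =>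
      backKernel_shift_of_lt _ s₀ y₀ (w := (s, y)) hs.1
    simp_rw [h]
    rw [lintegral_sub_right_eq_self (fun y => ‖heatKernelGrad v (s - s₀) y‖ₑ) y₀]
    exact lintegral_enorm_heatKernelGrad_le hpos v
  calc ∫⁻ s in Ioc s₀ (s₀ + T), ∫⁻ y, ‖backKernel (heatKernelGrad v) (s₀ - s, y - y₀)‖ₑ
      ≤ ∫⁻ s in Ioc s₀ (s₀ + T), ENNReal.ofReal (C * (s - s₀) ^ (-(1 / 2 : ℝ))) :=
        setLIntegral_mono' measurableSet_Ioc hslice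
    _ = ENNReal.ofReal (∫ s in Ioc s₀ (s₀ + T), C * (s - s₀) ^ (-(1 / 2 : ℝ))) := by
        rw [← ofReal_integral_eq_lintegral_ofReal ((integrableOn_Ioc_rpow_neg_half s₀ T).const_mul C)]
        refine (ae_restrict_mem measurableSet_Ioc).mono fun s hs => ?_
        exact mul_nonneg hC0 (Real.rpow_nonneg (sub_pos.2 hs.1).le _)
    _ = ENNReal.ofReal (C * (2 * Real.sqrt T)) := by
        rw [integral_const_mul, setIntegral_Ioc_rpow_neg_half s₀ hT]

/-- `k_v` is integrable on every slab `(s₀, s₀ + T] × E`. [folklore] -/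
theorem integrableOn_slab_backKernel_heatKernelGrad_shift (v : E) (s₀ : ℝ) (y₀ : E) {T : ℝ}
    (hT : 0 ≤ T) :
    IntegrableOn (fun w : ℝ × E => backKernel (heatKernelGrad v) (s₀ - w.1, w.2 - y₀))
      (Ioc s₀ (s₀ + T) ×ˢ (univ : Set E)) volume := by
  refine ⟨(measurable_backKernel_heatKernelGrad_shift v s₀ y₀).aestronglyMeasurable, ?_⟩
  rw [hasFiniteIntegral_iff_enorm]
  exact (lintegral_slab_backKernel_heatKernelGrad_shift_le v s₀ y₀ hT).trans_lt ENNReal.ofReal_lt_top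

/-- **Slab integral of `|k_v|`, real form**: `∫_{(s₀, s₀+T] × E} |k_v| ≤ 2^{d/2} ‖v‖ · 2√T`.
[folklore] -/
theorem setIntegral_slab_abs_backKernel_heatKernelGrad_shift_le (v : E) (s₀ : ℝ) (y₀ : E) {T : ℝ}
    (hT : 0 ≤ T) :
    ∫ w in Ioc s₀ (s₀ + T) ×ˢ (univ : Set E), |backKernel (heatKernelGrad v) (s₀ - w.1, w.2 - y₀)| ≤
      (2 : ℝ) ^ ((Module.finrank ℝ E : ℝ) / 2) * ‖v‖ * (2 * Real.sqrt T) := by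
  have hi := (integrableOn_slab_backKernel_heatKernelGrad_shift v s₀ y₀ hT).norm
  rw [show (fun w : ℝ × E => |backKernel (heatKernelGrad v) (s₀ - w.1, w.2 - y₀)|) =
      fun w => ‖backKernel (heatKernelGrad v) (s₀ - w.1, w.2 - y₀)‖ from rfl]
  rw [integral_norm_eq_lintegral_enorm
    (measurable_backKernel_heatKernelGrad_shift v s₀ y₀).aestronglyMeasurable]
  have h := lintegral_slab_backKernel_heatKernelGrad_shift_le v s₀ y₀ hT
  have hfin : ∫⁻ w in Ioc s₀ (s₀ + T) ×ˢ (univ : Set E),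
      ‖backKernel (heatKernelGrad v) (s₀ - w.1, w.2 - y₀)‖ₑ ≠ ∞ :=
    (h.trans_lt ENNReal.ofReal_lt_top).ne
  have hnn : 0 ≤ (2 : ℝ) ^ ((Module.finrank ℝ E : ℝ) / 2) * ‖v‖ * (2 * Real.sqrt T) := by positivity
  exact (ENNReal.toReal_le_toReal hfin ENNReal.ofReal_ne_top).2 h |>.trans (by rw [ENNReal.toReal_ofReal hnn])

/-! ### Shell bounds -/

omit [MeasurableSpace E] [BorelSpace E] in
/-- Powers of `ρ ∈ (0, 1]`: `ρ^{-k} ≤ ρ^{-(d+1)}` for `k ≤ d + 1` (real exponent on the left,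
natural on the right). [folklore] -/
theorem rpow_neg_le_inv_pow {ρ : ℝ} (hρ : 0 < ρ) (hρ1 : ρ ≤ 1) {k : ℝ} {m : ℕ}
    (hk : k ≤ m) : ρ ^ (-k) ≤ 1 / ρ ^ m := by
  rw [Real.rpow_neg hρ.le, one_div, ← Real.rpow_natCast]
  refine inv_anti₀ (Real.rpow_pos_of_pos hρ _) ?_
  exact Real.rpow_le_rpow_of_exponent_ge hρ hρ1 hk

omit [FiniteDimensional ℝ E] [MeasurableSpace E] [BorelSpace E] in
/-- **Shell bounds for the two kernels.** There is `B = B(E) > 0` such that for `0 < ρ ≤ 1`,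
`‖v‖ ≤ 1`, every base point `(s₀, y₀)` and every `w = (s, y)` off the parabolic half-ball of
radius `ρ/√2` — i.e. `s - s₀ ≥ ρ²/2` or `‖y - y₀‖ ≥ ρ/2` — both kernels are bounded by
`B ρ^{-(d+1)}`, `d = dim E`:
`|k_G(w)| ≤ B/ρ^{d+1}` and `|k_v(w)| ≤ B/ρ^{d+1}` (Gaussian decay against the parabolic
distance; Koch–Tataru 2001, §2 (8)). [folklore] -/
theorem exists_shell_bound :
    ∃ B : ℝ, 0 < B ∧ ∀ {ρ : ℝ}, 0 < ρ → ρ ≤ 1 → ∀ (s₀ : ℝ) (y₀ v : E), ‖v‖ ≤ 1 →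
      ∀ w : ℝ × E, (ρ ^ 2 / 2 ≤ w.1 - s₀ ∨ ρ / 2 ≤ ‖w.2 - y₀‖) →
        |backKernel (UnboundedOperators.heatKernel (E := E)) (s₀ - w.1, w.2 - y₀)| ≤
            B / ρ ^ (Module.finrank ℝ E + 1) ∧
          |backKernel (heatKernelGrad v) (s₀ - w.1, w.2 - y₀)| ≤ B / ρ ^ (Module.finrank ℝ E + 1) := by
  set d : ℕ := Module.finrank ℝ E with hd
  obtain ⟨C₁, hC₁, h₁⟩ := exists_heatKernel_le_of_le_norm (E := E)
  obtain ⟨C₂, hC₂, h₂⟩ := exists_abs_heatKernelGrad_le_of_le_norm (E := E)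
  obtain ⟨C₃, hC₃, h₃⟩ := exists_abs_heatKernelGrad_le_of_le (E := E)
  -- the constant
  refine ⟨C₁ * 2 ^ d + C₂ * 2 ^ (d + 1) + 1 + C₃ * 2 ^ (d + 1), by positivity,
    fun {ρ} hρ hρ1 s₀ y₀ v hv w hw => ?_⟩
  have hρd : 0 < ρ ^ (d + 1) := pow_pos hρ _
  have hB0 : 0 ≤ (C₁ * 2 ^ d + C₂ * 2 ^ (d + 1) + 1 + C₃ * 2 ^ (d + 1)) / ρ ^ (d + 1) := by positivity
  by_cases hle : w.1 ≤ s₀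
  · rw [backKernel_shift_eq_zero_of_le _ s₀ y₀ hle, backKernel_shift_eq_zero_of_le _ s₀ y₀ hle,
      abs_zero]
    exact ⟨hB0, hB0⟩
  have hlt : s₀ < w.1 := not_le.1 hle
  have ha : 0 < w.1 - s₀ := sub_pos.2 hlt
  rw [backKernel_shift_of_lt _ s₀ y₀ hlt, backKernel_shift_of_lt _ s₀ y₀ hlt]
  -- each of the four elementary bounds is `≤ B/ρ^{d+1}`
  have h2d : (0 : ℝ) ≤ 2 ^ d := by positivity
  have h2d1 : (0 : ℝ) ≤ 2 ^ (d + 1) := by positivity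
  have n1 : 0 ≤ C₁ * 2 ^ d := mul_nonneg hC₁.le h2d
  have n2 : 0 ≤ C₂ * 2 ^ (d + 1) := mul_nonneg hC₂.le h2d1
  have n4 : 0 ≤ C₃ * 2 ^ (d + 1) := mul_nonneg hC₃.le h2d1
  have e1 : C₁ * 2 ^ d / ρ ^ (d + 1) ≤ (C₁ * 2 ^ d + C₂ * 2 ^ (d + 1) + 1 + C₃ * 2 ^ (d + 1)) / ρ ^ (d + 1) :=
    div_le_div_of_nonneg_right (by linarith) hρd.le
  have e2 : C₂ * 2 ^ (d + 1) / ρ ^ (d + 1) ≤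
      (C₁ * 2 ^ d + C₂ * 2 ^ (d + 1) + 1 + C₃ * 2 ^ (d + 1)) / ρ ^ (d + 1) :=
    div_le_div_of_nonneg_right (by linarith) hρd.le
  have e3 : 1 / ρ ^ (d + 1) ≤ (C₁ * 2 ^ d + C₂ * 2 ^ (d + 1) + 1 + C₃ * 2 ^ (d + 1)) / ρ ^ (d + 1) :=
    div_le_div_of_nonneg_right (by linarith) hρd.le
  have e4 : C₃ * 2 ^ (d + 1) / ρ ^ (d + 1) ≤
      (C₁ * 2 ^ d + C₂ * 2 ^ (d + 1) + 1 + C₃ * 2 ^ (d + 1)) / ρ ^ (d + 1) :=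
    div_le_div_of_nonneg_right (by linarith) hρd.le
  rcases hw with hw | hw
  · -- the time shell `a = w.1 - s₀ ≥ ρ²/2`
    have hε : 0 < ρ ^ 2 / 2 := by positivity
    constructor
    · -- `G_a ≤ (4π ρ²/2)^{-d/2} ≤ (ρ²)^{-d/2} = ρ^{-d} ≤ 1/ρ^{d+1}`
      have hG := abs_heatKernel_le_of_le hε hw (w.2 - y₀)
      refine hG.trans (le_trans ?_ e3)
      have hbase : ρ ^ 2 ≤ 4 * π * (ρ ^ 2 / 2) := by nlinarith [Real.pi_gt_three, sq_nonneg ρ]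
      calc (4 * π * (ρ ^ 2 / 2)) ^ (-(d : ℝ) / 2) ≤ (ρ ^ 2) ^ (-(d : ℝ) / 2) :=
            Real.rpow_le_rpow_of_nonpos (by positivity) hbase
              (by rw [neg_div]; exact neg_nonpos.2 (by positivity))
        _ = ρ ^ (-(d : ℝ)) := by
            rw [← Real.rpow_natCast ρ 2, ← Real.rpow_mul hρ.le]
            congr 1; push_cast; ring
        _ ≤ 1 / ρ ^ (d + 1) := rpow_neg_le_inv_pow hρ hρ1 (by push_cast; linarith)
    · -- `|∂ᵥG_a| ≤ C₃ ‖v‖ (ρ²/2)^{-(d+1)/2} ≤ C₃ 2^{d+1} / ρ^{d+1}`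
      have hG := h₃ hε hw v (w.2 - y₀)
      refine hG.trans (le_trans ?_ e4)
      have hv' : C₃ * ‖v‖ ≤ C₃ := by nlinarith
      have hpow : (ρ ^ 2 / 2) ^ (-(((d : ℝ) + 1) / 2)) ≤ 2 ^ (d + 1) / ρ ^ (d + 1) := by
        -- `(ρ²/2)^{-(d+1)/2} ≤ (ρ²/4)^{-(d+1)/2} = (ρ/2)^{-(d+1)} = 2^{d+1} ρ^{-(d+1)}`
        calc (ρ ^ 2 / 2) ^ (-(((d : ℝ) + 1) / 2)) ≤ ((ρ / 2) ^ 2) ^ (-(((d : ℝ) + 1) / 2)) :=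
              Real.rpow_le_rpow_of_nonpos (by positivity) (by nlinarith [sq_nonneg ρ])
                (neg_nonpos.2 (by positivity))
          _ = (ρ / 2) ^ (-((d : ℝ) + 1)) := by
              rw [← Real.rpow_natCast (ρ / 2) 2, ← Real.rpow_mul (by positivity)]
              congr 1; push_cast; ring
          _ = 2 ^ (d + 1) / ρ ^ (d + 1) := by
              rw [Real.rpow_neg (by positivity), show ((d : ℝ) + 1) = ((d + 1 : ℕ) : ℝ) by push_cast; ring,
                Real.rpow_natCast, div_pow, inv_div]
      calc C₃ * ‖v‖ * (ρ ^ 2 / 2) ^ (-(((d : ℝ) + 1) / 2))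
          ≤ C₃ * (2 ^ (d + 1) / ρ ^ (d + 1)) :=
            mul_le_mul hv' hpow (Real.rpow_nonneg (by positivity) _) hC₃.le
        _ = C₃ * 2 ^ (d + 1) / ρ ^ (d + 1) := by ring
  · -- the space shell `‖y - y₀‖ ≥ ρ/2`
    have hδ : 0 < ρ / 2 := by positivity
    constructor
    · have hG := h₁ ha hδ (w.2 - y₀) hw
      refine hG.trans (le_trans ?_ e1)
      have hpow : (ρ / 2) ^ (-(d : ℝ)) ≤ 2 ^ d / ρ ^ (d + 1) := by
        rw [Real.rpow_neg hδ.le, Real.rpow_natCast, div_pow, inv_div]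
        rw [div_le_div_iff₀ (pow_pos hρ d) hρd]
        have : ρ ^ (d + 1) ≤ ρ ^ d := pow_le_pow_of_le_one hρ.le hρ1 (Nat.le_succ d)
        nlinarith [pow_pos (two_pos (α := ℝ)) d]
      calc C₁ * (ρ / 2) ^ (-(d : ℝ)) ≤ C₁ * (2 ^ d / ρ ^ (d + 1)) :=
            mul_le_mul_of_nonneg_left hpow hC₁.le
        _ = C₁ * 2 ^ d / ρ ^ (d + 1) := by ring
    · have hG := h₂ ha hδ v (w.2 - y₀) hw
      refine hG.trans (le_trans ?_ e2)
      have hv' : C₂ * ‖v‖ ≤ C₂ := by nlinarith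
      have hpow : (ρ / 2) ^ (-((d : ℝ) + 1)) = 2 ^ (d + 1) / ρ ^ (d + 1) := by
        rw [Real.rpow_neg hδ.le, show ((d : ℝ) + 1) = ((d + 1 : ℕ) : ℝ) by push_cast; ring,
          Real.rpow_natCast, div_pow, inv_div]
      calc C₂ * ‖v‖ * (ρ / 2) ^ (-((d : ℝ) + 1)) ≤ C₂ * (2 ^ (d + 1) / ρ ^ (d + 1)) := by
            rw [hpow]; exact mul_le_mul_of_nonneg_right hv' (by positivity)
        _ = C₂ * 2 ^ (d + 1) / ρ ^ (d + 1) := by ring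

end Carleman

end Literature.Analysis.FluidPDE
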